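import Summits.ResolutionOfSingularities.ResolutionOfSingularities.Theorems.WeightedInvariantHypersurfaceLocalGameEFTDimTwoSteepening
import HarnessLib

/-!
# The e.f.t. local weighted game (door `HypersurfaceCentreConstruction`): Newton data — unit monomial expansions

Topic: `Summits/ResolutionOfSingularities/ResolutionOfSingularities/Theorems`. Helper for the door item
`HypersurfaceCentreConstruction` (statement `stmt-ResolutionOfSingularities-19897`, route `WeightedInvariant`),
line `local-engine` of `res-L1-w43-plan-1` (L W4.3), ORDER (o13) «the `dim S = 2` rung of H2a′» held by
res-type-098: kernel **K5 «Newton data»** of the design memo `L/res-type-098-w43/EFT-DIM2-DESIGN.md` v2 §B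
(dealt to res-type-092 by res-L1-w43-plan-1 RULINGS gen 8 #2/#3, 2026-08-27T07:02:44Z), PART 2; PART 1 is
`…EFTDimTwoSteepening` (the weighted-filtration side: faces, face uniqueness, steepening; res-type-078's text).

This part is the Δ-EXPANSION currency of K3a's `LocalGameEFTPointMove.transform`
(`…EFTPointMoveChart`, p507345): `f = Σ_{α ∈ Δ} a_α u^α + r` with UNIT coefficients `a_α ∈ Sˣ`, a finite set
of exponents `Δ : Finset (Fin d → ℕ)` and a remainder `r ∈ 𝔪^N`.

* §1 (any local ring `S`, `u : Fin d → S` generating `𝔪`): `weightedMonomialIdeal_const_one_eq_pow` (`𝒥ₙ(u; 1,…,1) = 𝔪ⁿ`)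
  and **`exists_unitExpansion`** — for every `N` such an expansion exists with `|α| < N` on `Δ` (peel `𝔪^N = (u^α : |α| = N)`
  degree by degree, keeping the unit coefficients and pushing the non-units into `𝔪^{N+1}`).
* §2 (`S` regular local of dimension `d`, positive weights `w`; weighted quasi-regularity of a regular system of parameters,
  tree `weightedQuasiRegular_of_linearIndependent_toCotangent`): `coeff_layer_sub_mem_maximalIdeal` (the weight-`k` layer
  of an expansion is determined modulo `𝔪` by `f` modulo `𝒥_{k+1}`); **`le_weight_of_mem_weightedMonomialIdeal`**
  (`f ∈ 𝒥ₘ` forces `w·α ≥ m` on `Δ`: unit monomials cannot hide in a higher piece), its easy converse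
  `mem_weightedMonomialIdeal_of_forall_le_weight`, the witness `exists_weight_lt_of_not_mem` (`f ∉ 𝒥ₘ ⇒` some `α ∈ Δ` with
  `w·α < m` — the «`β* < b + 1`» witness of case C), and `exists_degree_eq_of_not_mem_pow` (the tangent cone read on `Δ`:
  `f ∈ 𝔪^ν ∖ 𝔪^{ν+1}` ⇒ all `|α| ≥ ν`, some `|α| = ν`).
* the two-variable statements (prepared levels ⇒ face `{(0, ν)}`, the face read on an expansion, the (K5e) case-C
  export and the (K5d)→K6 chain) are in the sibling PART 3 `…EFTDimTwoNewtonFace` (split for the 400-line rule).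

Case E / Krull (`f ∈ ⋂_b ((y^ν) + 𝔪^b) ⇒ f ∈ (y^ν)`) is K6's `LocalGameEFTContact.mem_of_forall_mem_sup_pow` (p505670) and
is not restated. [OURS · L1 W4.3] Replaces the role of NO printed item; NOT a statement of the manuscript under review
(Hironaka 2017). AI work, weaker than expert review. Def-free; `--supports stmt-ResolutionOfSingularities-19897 --as helper`.

## References

* J. Włodarczyk, *Functorial resolution by torus actions*, arXiv:2203.03090, Lemma 2.1.12 (weighted monomial
  filtrations `(u^α | Σ αᵢwᵢ ≥ a)`), §3.3 (the form `f = t^{-m} G`). [Wlodarczyk2022]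
* H. Matsumura, *Commutative Ring Theory*, Thm. 16.2 (quasi-regular sequences), Thm. 14.2. [Matsumura1987]
-/

noncomputable section

open IsLocalRing Literature.AlgebraicGeometry.Resolution

set_option linter.dupNamespace false -- mandated namespace of this single-conjunct summit

namespace Summit.ResolutionOfSingularities.ResolutionOfSingularities.Theorems

namespace LocalGameEFTNewton

universe u

variable {S : Type u} [CommRing S]

/-! ### §1 Unit monomial expansions in a local ring -/

section Expansion

variable [IsLocalRing S] {d : ℕ} (u : Fin d → S) (hu : Ideal.span (Set.range u) = maximalIdeal S)

include hu in
/-- Each parameter lies in `𝔪`. [folklore] -/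
theorem mem_maximalIdeal_of_span_eq (i : Fin d) : u i ∈ maximalIdeal S :=
  hu ▸ Ideal.subset_span ⟨i, rfl⟩

include hu in
/-- A monomial `u^α` lies in `𝔪^{|α|}`. [folklore] -/
theorem prod_pow_mem_pow (α : Fin d → ℕ) : ∏ i, u i ^ α i ∈ maximalIdeal S ^ (∑ i, α i) := by
  rw [← Finset.prod_pow_eq_pow_sum]
  exact Ideal.prod_mem_prod fun i _ => Ideal.pow_mem_pow (mem_maximalIdeal_of_span_eq u hu i) (α i)

include hu in
/-- **`𝒥ₙ(u; 1, …, 1) = 𝔪ⁿ`**: with all weights one the weighted monomial filtration of a system of generators of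
`𝔪` is the `𝔪`-adic one. [cite: Wlodarczyk2022, Lemma 2.1.12] -/
theorem weightedMonomialIdeal_const_one_eq_pow (n : ℕ) :
    weightedMonomialIdeal u (fun _ => 1) n = maximalIdeal S ^ n := by
  refine le_antisymm ?_ (pow_le_weightedMonomialIdeal_of_span_eq u (fun _ => 1) (fun _ => one_pos) hu n)
  rw [weightedMonomialIdeal, Ideal.span_le]
  rintro _ ⟨α, hα, rfl⟩
  simp only [one_mul] at hα
  exact Ideal.pow_le_pow_right hα (prod_pow_mem_pow u hu α)

include hu in
/-- `𝔪^N` is spanned, as an `S`-module, by the monomials of total degree `≥ N`. [folklore] -/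
theorem pow_eq_span_image (N : ℕ) :
    maximalIdeal S ^ N =
      Submodule.span S ((fun α : Fin d → ℕ => ∏ i, u i ^ α i) '' {α | N ≤ ∑ i, α i}) := by
  rw [← weightedMonomialIdeal_const_one_eq_pow u hu N, weightedMonomialIdeal, Ideal.span]
  congr 1
  ext z
  simp only [one_mul, Set.mem_setOf_eq, Set.mem_image]
  constructor
  · rintro ⟨α, hα, rfl⟩
    exact ⟨α, hα, rfl⟩
  · rintro ⟨α, hα, rfl⟩
    exact ⟨α, hα, rfl⟩

include hu in
/-- **Unit monomial expansions.** In a local ring `S` with `𝔪 = (u₁, …, u_d)`, every `f` is, for every `N`, a finite sum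
`Σ_{α ∈ Δ} a_α u^α` of monomials of total degree `< N` with UNIT coefficients, up to a remainder in `𝔪^N`.
(Peel degree by degree: a non-unit coefficient in degree `N` is absorbed into `𝔪^{N+1}`.) [folklore] -/
theorem exists_unitExpansion (f : S) (N : ℕ) :
    ∃ (Δ : Finset (Fin d → ℕ)) (a : (Fin d → ℕ) → S),
      (∀ α ∈ Δ, IsUnit (a α)) ∧ (∀ α ∈ Δ, ∑ i, α i < N) ∧
        f - ∑ α ∈ Δ, a α * ∏ i, u i ^ α i ∈ maximalIdeal S ^ N := by
  classical
  induction N with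
  | zero => exact ⟨∅, 0, by simp, by simp, by simp⟩
  | succ N ih =>
    obtain ⟨Δ, a, hunit, hdeg, hrem⟩ := ih
    set v : (Fin d → ℕ) → S := fun α => ∏ i, u i ^ α i with hv
    -- expand the remainder on the monomials of degree `≥ N`
    have hrem' : f - ∑ α ∈ Δ, a α * v α ∈
        Submodule.span S (v '' {α : Fin d → ℕ | N ≤ ∑ i, α i}) := by
      rw [← pow_eq_span_image u hu N]
      exact hrem
    obtain ⟨l, hl, hsum⟩ := (Finsupp.mem_span_image_iff_linearCombination S).mp hrem'
    have hsupp : ∀ α ∈ l.support, N ≤ ∑ i, α i := fun α hα => hl hα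
    rw [Finsupp.linearCombination_apply, Finsupp.sum] at hsum
    simp only [smul_eq_mul] at hsum
    -- the new exponents: degree exactly `N` with a unit coefficient
    set Δ₁ : Finset (Fin d → ℕ) := l.support.filter (fun α => ∑ i, α i = N ∧ IsUnit (l α)) with hΔ₁
    have hdisj : Disjoint Δ Δ₁ := by
      rw [Finset.disjoint_left]
      intro α hα hα₁
      have h1 := hdeg α hα
      have h2 := (Finset.mem_filter.mp hα₁).2.1
      omega
    set a' : (Fin d → ℕ) → S := fun α => if α ∈ Δ then a α else l α with ha'
    have ha'Δ : ∀ α ∈ Δ, a' α = a α := fun α hα => by rw [ha']; exact if_pos hα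
    have ha'Δ₁ : ∀ α ∈ Δ₁, a' α = l α := fun α hα => by
      rw [ha']; exact if_neg (Finset.disjoint_right.mp hdisj hα)
    refine ⟨Δ ∪ Δ₁, a', ?_, ?_, ?_⟩
    · intro α hα
      rcases Finset.mem_union.mp hα with h | h
      · rw [ha'Δ α h]; exact hunit α h
      · rw [ha'Δ₁ α h]; exact (Finset.mem_filter.mp h).2.2
    · intro α hα
      rcases Finset.mem_union.mp hα with h | h
      · exact Nat.lt_succ_of_lt (hdeg α h)
      · exact (Finset.mem_filter.mp h).2.1 ▸ Nat.lt_succ_self N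
    · rw [Finset.sum_union hdisj]
      have hΔ : ∑ α ∈ Δ, a' α * v α = ∑ α ∈ Δ, a α * v α :=
        Finset.sum_congr rfl fun α hα => by rw [ha'Δ α hα]
      have hΔ₁' : ∑ α ∈ Δ₁, a' α * v α = ∑ α ∈ Δ₁, l α * v α :=
        Finset.sum_congr rfl fun α hα => by rw [ha'Δ₁ α hα]
      rw [hΔ, hΔ₁']
      -- the new remainder is the sum over the discarded exponents
      have hsplit : ∑ α ∈ l.support, l α * v α =
          ∑ α ∈ Δ₁, l α * v α + ∑ α ∈ l.support.filter (fun α => ¬ (∑ i, α i = N ∧ IsUnit (l α))),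
            l α * v α := by
        rw [hΔ₁, ← Finset.sum_filter_add_sum_filter_not l.support (fun α => ∑ i, α i = N ∧ IsUnit (l α))]
      have heq : f - (∑ α ∈ Δ, a α * v α + ∑ α ∈ Δ₁, l α * v α) =
          ∑ α ∈ l.support.filter (fun α => ¬ (∑ i, α i = N ∧ IsUnit (l α))), l α * v α := by
        have h1 : f - ∑ α ∈ Δ, a α * v α = ∑ α ∈ l.support, l α * v α := hsum.symm
        rw [← sub_sub, h1, hsplit, add_sub_cancel_left]
      rw [heq]
      refine Ideal.sum_mem _ fun α hα => ?_
      obtain ⟨hαs, hnot⟩ := Finset.mem_filter.mp hα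
      have hN := hsupp α hαs
      by_cases hdegN : ∑ i, α i = N
      · -- degree `N`, non-unit coefficient: `l α ∈ 𝔪`
        have hlα : l α ∈ maximalIdeal S := by
          rw [mem_maximalIdeal, mem_nonunits_iff]
          exact fun hu' => hnot ⟨hdegN, hu'⟩
        have := Ideal.mul_mem_mul hlα (prod_pow_mem_pow u hu α)
        rw [hdegN, ← pow_succ'] at this
        exact this
      · -- degree `> N`
        have hgt : N + 1 ≤ ∑ i, α i := by omega
        exact Ideal.mul_mem_left _ _ (Ideal.pow_le_pow_right hgt (prod_pow_mem_pow u hu α))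

include hu in
/-- Easy converse: if every exponent of `Δ` has weight `≥ m` and `m ≤ N` then `f ∈ 𝒥ₘ`. [folklore] -/
theorem mem_weightedMonomialIdeal_of_forall_le_weight (w : Fin d → ℕ) (hw : ∀ i, 0 < w i) {f : S} {Δ : Finset (Fin d → ℕ)}
    {a : (Fin d → ℕ) → S} {N m : ℕ} (hr : f - ∑ α ∈ Δ, a α * ∏ i, u i ^ α i ∈ maximalIdeal S ^ N)
    (hge : ∀ α ∈ Δ, m ≤ ∑ i, w i * α i) (hmN : m ≤ N) : f ∈ weightedMonomialIdeal u w m := by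
  have hJ : maximalIdeal S ^ N ≤ weightedMonomialIdeal u w m :=
    (Ideal.pow_le_pow_right hmN).trans (pow_le_weightedMonomialIdeal_of_span_eq u w hw hu m)
  have hsum : ∑ α ∈ Δ, a α * ∏ i, u i ^ α i ∈ weightedMonomialIdeal u w m :=
    Ideal.sum_mem _ fun α hα => Ideal.mul_mem_left _ _ (prod_pow_mem_weightedMonomialIdeal u w α (hge α hα))
  have := Ideal.add_mem _ (hJ hr) hsum
  rwa [sub_add_cancel] at this

include hu in
/-- **The sub-slope witness** (case C of the memo, «`β* < b + 1`»): if `f ∉ 𝒥ₘ` and `m ≤ N`, some exponent of the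
expansion has weight `< m`. [folklore] -/
theorem exists_weight_lt_of_not_mem (w : Fin d → ℕ) (hw : ∀ i, 0 < w i) {f : S} {Δ : Finset (Fin d → ℕ)} {a : (Fin d → ℕ) → S}
    {N m : ℕ} (hr : f - ∑ α ∈ Δ, a α * ∏ i, u i ^ α i ∈ maximalIdeal S ^ N) (hmN : m ≤ N)
    (hf : f ∉ weightedMonomialIdeal u w m) : ∃ α ∈ Δ, ∑ i, w i * α i < m := by
  by_contra h
  push Not at h
  exact hf (mem_weightedMonomialIdeal_of_forall_le_weight u hu w hw hr h hmN)

end Expansion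

/-! ### Helpers on exponents -/

section Helpers

/-- The weight of a finitely supported exponent is the weight of the underlying function. [folklore] -/
theorem weight_equivFunOnFinite_symm {d : ℕ} (w : Fin d → ℕ) (α : Fin d → ℕ) :
    Finsupp.weight w (Finsupp.equivFunOnFinite.symm α) = ∑ i, w i * α i := by
  rw [Finsupp.weight_apply, Finsupp.sum_fintype _ _ (fun i => by simp)]
  simp [smul_eq_mul, mul_comm]

/-- Evaluating a monomial with function exponent. [folklore] -/
theorem eval_monomial_equivFunOnFinite_symm {d : ℕ} (u : Fin d → S) (α : Fin d → ℕ) (c : S) :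
    MvPolynomial.eval u (MvPolynomial.monomial (Finsupp.equivFunOnFinite.symm α) c) = c * ∏ i, u i ^ α i := by
  rw [MvPolynomial.eval_monomial, Finsupp.prod_fintype _ _ (fun i => pow_zero _)]
  simp

/-- `(x, y)` as a `Fin 2`-family generates `𝔪` when `(x, y) = 𝔪`. [folklore] -/
theorem span_range_vecCons_eq [IsLocalRing S] {x y : S} (hxy : Ideal.span {x, y} = maximalIdeal S) :
    Ideal.span (Set.range ![x, y]) = maximalIdeal S := by
  rw [Matrix.range_cons_cons_empty, hxy]

/-- The `(1, b)`-weight of a two-variable exponent. [folklore] -/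
theorem weight_two (b : ℕ) (α : Fin 2 → ℕ) : ∑ i, ![1, b] i * α i = α 0 + b * α 1 := by
  simp [Fin.sum_univ_two]

/-- The two-variable monomial. [folklore] -/
theorem prod_two (x y : S) (α : Fin 2 → ℕ) : ∏ i, ![x, y] i ^ α i = x ^ α 0 * y ^ α 1 := by
  simp [Fin.prod_univ_two]

/-- The top face coefficient read on an expansion is a unit exactly when the vertex `(0, ν)` is an exponent (with
`prepared_face` below: always, at a prepared level). [folklore] -/
theorem isUnit_face_top_iff [Nontrivial S] {Δ : Finset (Fin 2 → ℕ)} {a : (Fin 2 → ℕ) → S}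
    (hunit : ∀ α ∈ Δ, IsUnit (a α)) (b ν : ℕ) :
    IsUnit (if (![b * (ν - ν), ν] : Fin 2 → ℕ) ∈ Δ then a ![b * (ν - ν), ν] else 0) ↔
      (![0, ν] : Fin 2 → ℕ) ∈ Δ := by
  rw [Nat.sub_self, Nat.mul_zero]
  constructor
  · intro h
    by_contra hnot
    rw [if_neg hnot] at h
    exact not_isUnit_zero h
  · intro h
    rw [if_pos h]
    exact hunit _ h

end Helpers

/-! ### §2 Weighted independence of unit expansions (regular local rings) -/

section Independence

variable [IsRegularLocalRing S] {d : ℕ} (u : Fin d → S) (hu : Ideal.span (Set.range u) = maximalIdeal S)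
  (hdim : ringKrullDim S = d) (w : Fin d → ℕ) (hw : ∀ i, 0 < w i)

include hu hdim hw in
/-- **The weight-`k` layer of an expansion is determined modulo `𝔪`.**  Let `f = Σ_{α ∈ Δ} a_α u^α + r` with
`r ∈ 𝔪^N` (ANY coefficients), all exponents of `Δ` of weight `≥ k`, `k < N`, and let `Q` be a `w`-form of weight `k`
with `f - Q(u) ∈ 𝒥_{k+1}`.  Then the `w`-form `Σ_{α ∈ Δ, w·α = k} a_α X^α - Q` has all its coefficients in `𝔪` (weighted
quasi-regularity of the regular system of parameters `u`, tree `weightedQuasiRegular_of_linearIndependent_toCotangent`).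
[cite: Matsumura1987, Thm. 16.2] -/
theorem coeff_layer_sub_mem_maximalIdeal {f : S} {Δ : Finset (Fin d → ℕ)} {a : (Fin d → ℕ) → S} {N k : ℕ}
    (hr : f - ∑ α ∈ Δ, a α * ∏ i, u i ^ α i ∈ maximalIdeal S ^ N) (hge : ∀ α ∈ Δ, k ≤ ∑ i, w i * α i)
    (hkN : k < N) (Q : MvPolynomial (Fin d) S) (hQ : Q.IsWeightedHomogeneous w k)
    (hfQ : f - MvPolynomial.eval u Q ∈ weightedMonomialIdeal u w (k + 1)) (β : Fin d →₀ ℕ) :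
    (∑ α ∈ Δ.filter (fun α => ∑ i, w i * α i = k),
        MvPolynomial.monomial (Finsupp.equivFunOnFinite.symm α) (a α) - Q).coeff β ∈ maximalIdeal S := by
  classical
  have hmem : ∀ i, u i ∈ maximalIdeal S := mem_maximalIdeal_of_span_eq u hu
  have hli := linearIndependent_toCotangent_of_span_eq_maximalIdeal hdim u hu
  set P : MvPolynomial (Fin d) S := ∑ α ∈ Δ.filter (fun α => ∑ i, w i * α i = k),
    MvPolynomial.monomial (Finsupp.equivFunOnFinite.symm α) (a α) with hPdef
  -- `P` is a `w`-form of weight `k`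
  have hP : P.IsWeightedHomogeneous w k := by
    rw [← MvPolynomial.mem_weightedHomogeneousSubmodule]
    refine Submodule.sum_mem _ fun α hα => ?_
    rw [MvPolynomial.mem_weightedHomogeneousSubmodule]
    exact MvPolynomial.isWeightedHomogeneous_monomial w _ (a α)
      (by rw [weight_equivFunOnFinite_symm w, (Finset.mem_filter.mp hα).2])
  have hPQ : (P - Q).IsWeightedHomogeneous w k := by
    rw [← MvPolynomial.mem_weightedHomogeneousSubmodule] at hP hQ ⊢
    exact Submodule.sub_mem _ hP hQ
  -- `(P - Q)(u) ∈ 𝒥_{k+1}`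
  have hJ : maximalIdeal S ^ N ≤ weightedMonomialIdeal u w (k + 1) :=
    (Ideal.pow_le_pow_right hkN).trans (pow_le_weightedMonomialIdeal_of_span_eq u w hw hu (k + 1))
  have hevalP : MvPolynomial.eval u P = ∑ α ∈ Δ.filter (fun α => ∑ i, w i * α i = k), a α * ∏ i, u i ^ α i := by
    simp only [hPdef, map_sum, eval_monomial_equivFunOnFinite_symm u]
  have hhigh : ∑ α ∈ Δ.filter (fun α => ¬ ∑ i, w i * α i = k), a α * ∏ i, u i ^ α i ∈
      weightedMonomialIdeal u w (k + 1) := by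
    refine Ideal.sum_mem _ fun α hα => Ideal.mul_mem_left _ _ ?_
    obtain ⟨hαΔ, hne⟩ := Finset.mem_filter.mp hα
    exact prod_pow_mem_weightedMonomialIdeal u w α (by have := hge α hαΔ; omega)
  have heval : MvPolynomial.eval u (P - Q) ∈ (weightedFiltration u w).ideal (k + 1) := by
    rw [← weightedMonomialIdeal_eq_weightedFiltration_ideal, map_sub, hevalP]
    have hsplit : ∑ α ∈ Δ, a α * ∏ i, u i ^ α i =
        ∑ α ∈ Δ.filter (fun α => ∑ i, w i * α i = k), a α * ∏ i, u i ^ α i +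
          ∑ α ∈ Δ.filter (fun α => ¬ ∑ i, w i * α i = k), a α * ∏ i, u i ^ α i :=
      (Finset.sum_filter_add_sum_filter_not Δ _ _).symm
    have hkey : ∑ α ∈ Δ.filter (fun α => ∑ i, w i * α i = k), a α * ∏ i, u i ^ α i - MvPolynomial.eval u Q =
        (f - MvPolynomial.eval u Q) - (f - ∑ α ∈ Δ, a α * ∏ i, u i ^ α i) -
          ∑ α ∈ Δ.filter (fun α => ¬ ∑ i, w i * α i = k), a α * ∏ i, u i ^ α i := by
      rw [hsplit]; ring
    rw [hkey]
    exact Ideal.sub_mem _ (Ideal.sub_mem _ hfQ (hJ hr)) hhigh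
  have key := weightedQuasiRegular_of_linearIndependent_toCotangent u w hw hmem hli k (P - Q) hPQ heval β
  rwa [hu] at key

include hu hdim hw in
/-- **Unit monomials cannot hide in a higher piece.**  If `f = Σ_{α ∈ Δ} a_α u^α + r`, `a_α` units, `r ∈ 𝔪^N`, and
`f ∈ 𝒥ₘ(u; w)` with `m ≤ N`, then every exponent of `Δ` has weight `w·α ≥ m`.  [cite: Matsumura1987, Thm. 16.2] -/
theorem le_weight_of_mem_weightedMonomialIdeal {f : S} {Δ : Finset (Fin d → ℕ)} {a : (Fin d → ℕ) → S} {N m : ℕ}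
    (hunit : ∀ α ∈ Δ, IsUnit (a α)) (hr : f - ∑ α ∈ Δ, a α * ∏ i, u i ^ α i ∈ maximalIdeal S ^ N)
    (hf : f ∈ weightedMonomialIdeal u w m) (hmN : m ≤ N) : ∀ α ∈ Δ, m ≤ ∑ i, w i * α i := by
  classical
  -- induction on the level `k ≤ m`
  suffices H : ∀ k, k ≤ m → ∀ α ∈ Δ, k ≤ ∑ i, w i * α i from H m le_rfl
  intro k
  induction k with
  | zero => intro _ α _; exact Nat.zero_le _
  | succ k ih =>
    intro hkm α hα
    have hge := ih (Nat.le_of_succ_le hkm)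
    by_contra hlt
    have heq : ∑ i, w i * α i = k := by have := hge α hα; omega
    -- the weight-`k` layer against `Q = 0`: `f ∈ 𝒥ₘ ⊆ 𝒥_{k+1}`
    have hfQ : f - MvPolynomial.eval u (0 : MvPolynomial (Fin d) S) ∈ weightedMonomialIdeal u w (k + 1) := by
      rw [map_zero, sub_zero]
      exact weightedMonomialIdeal_antitone u w hkm hf
    have hcoeff := coeff_layer_sub_mem_maximalIdeal u hu hdim w hw hr hge (by omega) 0
      (MvPolynomial.isWeightedHomogeneous_zero S w k) hfQ (Finsupp.equivFunOnFinite.symm α)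
    rw [sub_zero, MvPolynomial.coeff_sum, Finset.sum_eq_single α
        (fun α' hα' hne => by
          rw [MvPolynomial.coeff_monomial, if_neg]
          exact fun h => hne (Finsupp.equivFunOnFinite.symm.injective h))
        (fun h => absurd (Finset.mem_filter.mpr ⟨hα, heq⟩) h),
      MvPolynomial.coeff_monomial, if_pos rfl] at hcoeff
    exact (mem_maximalIdeal _).mp hcoeff (hunit α hα)

include hu hdim in
/-- **The tangent cone read on `Δ`**: if `f ∈ 𝔪^ν ∖ 𝔪^{ν+1}` and `ν < N` then every exponent of a unit expansion has total
degree `≥ ν` and at least one has degree exactly `ν` (those are the monomials of the initial form of `f`).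
[cite: Matsumura1987, Thm. 16.2] -/
theorem exists_degree_eq_of_not_mem_pow {f : S} {Δ : Finset (Fin d → ℕ)} {a : (Fin d → ℕ) → S} {N ν : ℕ}
    (hunit : ∀ α ∈ Δ, IsUnit (a α)) (hr : f - ∑ α ∈ Δ, a α * ∏ i, u i ^ α i ∈ maximalIdeal S ^ N)
    (hν : f ∈ maximalIdeal S ^ ν) (hν' : f ∉ maximalIdeal S ^ (ν + 1)) (hνN : ν < N) :
    (∀ α ∈ Δ, ν ≤ ∑ i, α i) ∧ ∃ α ∈ Δ, ∑ i, α i = ν := by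
  have hone : ∀ i : Fin d, 0 < (fun _ : Fin d => 1) i := fun _ => one_pos
  have hge : ∀ α ∈ Δ, ν ≤ ∑ i, α i := by
    have h := le_weight_of_mem_weightedMonomialIdeal u hu hdim (fun _ => 1) hone hunit hr
      (by rw [weightedMonomialIdeal_const_one_eq_pow u hu]; exact hν) hνN.le
    simpa only [one_mul] using h
  refine ⟨hge, ?_⟩
  by_contra hnone
  push Not at hnone
  apply hν'
  rw [← weightedMonomialIdeal_const_one_eq_pow u hu]
  refine mem_weightedMonomialIdeal_of_forall_le_weight u hu (fun _ => 1) hone hr (fun α hα => ?_) (by omega)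
  have h1 := hge α hα
  have h2 := hnone α hα
  simp only [one_mul]
  omega

end Independence

end LocalGameEFTNewton

end Summit.ResolutionOfSingularities.ResolutionOfSingularities.Theorems

end
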